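import Literature.ModelTheory.ExponentialFields.Wilkie1989HeightZero
import HarnessLib

/-!
# Wilkie 1989, §6: permuting the variables of `k[x̄]ᵉ` and of the chains of subrings

Trunk `TranscendEllArithS`, family `periods` (periods.S28): infrastructure for the leaf
`Literature.ModelTheory.ExponentialFields.Wilkie1989_expAlgebraicPoints_mem` (`Wilkie1989.lean`;
§6 of A. J. Wilkie, *On the theory of the real exponential field*, Illinois J. Math. 33 (1989),
384–408).

In the proof of Theorem 2 (§6, p. 405): "Now since `(dg₁ ∧ ⋯ ∧ dgₙ₋₁)(ᾱ) ≠ 0` we may suppose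
(by permuting variables if necessary) that `(det J)(ᾱ) ≠ 0` where
`J = ∂(g₁, …, gₙ₋₁)/∂(x₂, …, xₙ)`."  Lemmas 4 and 6 (and their transfer to the models of
`T_exp`) single out the first coordinate `x₁`; this file provides the permutation of variables in
the tree's set-up (`Wilkie1989Lemma3Proofs.lean`: the ring `k[x̄]ᵉ` of term functions
`RealExpModel.termFnRing f n`, its derivations `RealExpModel.pd`, the chains `RealExpModel.chain`),
all **proved**:

* `RealExpModel.permFn f n σ : k[x̄]ᵉ →+* k[x̄]ᵉ`, `F ↦ (x̄ ↦ F(x̄ ∘ σ))` for a permutation `σ`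
  of the indices (the function of the relabelled term), an automorphism
  (`permFn_symm_apply`, `permFn_apply_symm`), with the chain rule
  `∂(F ∘ σ)/∂xₗ = (∂F/∂x_{σ⁻¹ l}) ∘ σ` (`pd_permFn`), gradient rows (`jrow_permFn`) and the
  transport of non-singular zero sets (`mem_VnsF_comp_permFn`: `x̄ ∈ Vⁿˢ(F̄ ∘ σ) ↔ x̄ ∘ σ ∈ Vⁿˢ(F̄)`);
* the polynomial stage `Mₙ = k[x̄]` is the range of `RealExpModel.polyFn`
  (`Wilkie1989HeightZero.lean`) for every choice of exponents (`chain_n_eq_range_polyFn`), and is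
  preserved by `permFn` (`permFn_polyFn`: `(polyFn P) ∘ σ = polyFn (rename σ P)`);
* the permuted chain: exponents `RealExpModel.permExp f n σ g = permFn σ ∘ g`, with
  `permFn σ (M_m) ⊆ M^σ_m` for `m ≥ n` (`permFn_mem_chain`), the generators
  (`permFn_chainGen_of_le`), admissibility (`permExp_admissible`) and degrees (`DegLT.permFn`).

## References

* A. J. Wilkie, *On the theory of the real exponential field*, Illinois J. Math. 33 (1989),
  384–408: §6, p. 405.
-/

noncomputable section

open FirstOrder FirstOrder.Language FirstOrder.Language.Structure
open Polynomial

namespace Literature.ModelTheory.ExponentialFields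

namespace RealExpModel

variable {k K : Language.Theory.ModelType.{0, 0, 0} realExpTheory}
  (f : k ↪[Language.orderedExpRing] K) (n : ℕ)

/-! ### Permuting the variables of `k[x̄]ᵉ` -/

/-- **Permutation of the variables**: for a permutation `σ` of `{1, …, n}`, the ring homomorphism
`k[x̄]ᵉ → k[x̄]ᵉ`, `F ↦ (x̄ ↦ F(x̄ ∘ σ))` — the function of the term with its variables relabelled by
`σ` (Wilkie 1989, p. 405: "by permuting variables if necessary"). [cite: Wilkie1989, §6, p. 405] -/
def permFn (σ : Equiv.Perm (Fin n)) : termFnRing f n →+* termFnRing f n where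
  toFun F :=
    ⟨fun x => (F : (Fin n → K) → K) (x ∘ σ), (reprTerm f n F).relabel (Sum.map _root_.id σ),
      funext fun x => by
        rw [termFn_apply, Term.realize_relabel]
        have : (Sum.elim (f : k → K) x ∘ Sum.map _root_.id σ : k ⊕ Fin n → K) =
            Sum.elim (f : k → K) (x ∘ σ) := by
          funext z; rcases z with z | z <;> rfl
        rw [this, realize_reprTerm]⟩
  map_one' := Subtype.ext (funext fun _ => rfl)
  map_mul' F G := Subtype.ext (funext fun _ => rfl)
  map_zero' := Subtype.ext (funext fun _ => rfl)
  map_add' F G := Subtype.ext (funext fun _ => rfl)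

variable {f n}

/-- Values of a permuted function. [folklore] -/
@[simp] theorem coe_permFn (σ : Equiv.Perm (Fin n)) (F : termFnRing f n) (x : Fin n → K) :
    ((permFn f n σ F : termFnRing f n) : (Fin n → K) → K) x = (F : (Fin n → K) → K) (x ∘ σ) := rfl

/-- Permuting the function of a term gives the function of the relabelled term. [folklore] -/
theorem permFn_fnOf (σ : Equiv.Perm (Fin n)) (t : Language.orderedExpRing.Term (k ⊕ Fin n)) :
    permFn f n σ (fnOf f n t) = fnOf f n (t.relabel (Sum.map _root_.id σ)) := by
  apply Subtype.ext
  funext x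
  rw [coe_permFn, coe_fnOf, coe_fnOf, termFn_apply, termFn_apply, Term.realize_relabel]
  congr 1
  funext z; rcases z with z | z <;> rfl

/-- `permFn σ⁻¹ ∘ permFn σ = id`. [folklore] -/
@[simp] theorem permFn_symm_apply (σ : Equiv.Perm (Fin n)) (F : termFnRing f n) :
    permFn f n σ.symm (permFn f n σ F) = F :=
  Subtype.ext (funext fun x => by simp [Function.comp_assoc])

/-- `permFn σ ∘ permFn σ⁻¹ = id`. [folklore] -/
@[simp] theorem permFn_apply_symm (σ : Equiv.Perm (Fin n)) (F : termFnRing f n) :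
    permFn f n σ (permFn f n σ.symm F) = F :=
  Subtype.ext (funext fun x => by simp [Function.comp_assoc])

/-- **The chain rule for a permutation of variables**: `∂(F ∘ σ)/∂xₗ = (∂F/∂x_{σ⁻¹ l}) ∘ σ`.
[folklore] -/
theorem pd_permFn (σ : Equiv.Perm (Fin n)) (l : Fin n) (F : termFnRing f n) :
    pd f n l (permFn f n σ F) = permFn f n σ (pd f n (σ.symm l) F) := by
  obtain ⟨t, rfl⟩ := exists_fnOf_eq f n F
  rw [permFn_fnOf, pd_fnOf, pd_fnOf, permFn_fnOf]
  apply Subtype.ext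
  funext x
  rw [coe_fnOf, coe_fnOf, termFn_apply, termFn_apply, Term.realize_relabel]
  conv_lhs => rw [← σ.apply_symm_apply l]
  rw [realize_termPDeriv_relabel_of_injective σ.injective]

/-- Gradient rows of a permuted function: `∇(F ∘ σ)(x̄) = ∇F(x̄ ∘ σ) ∘ σ⁻¹`. [folklore] -/
theorem jrow_permFn (σ : Equiv.Perm (Fin n)) (F : termFnRing f n) (x : Fin n → K) :
    jrow f n (permFn f n σ F) x = jrow f n F (x ∘ σ) ∘ σ.symm := by
  funext l
  simp [jrow, pd_permFn]

/-- Permutation of constants. [folklore] -/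
@[simp] theorem permFn_constFn (σ : Equiv.Perm (Fin n)) (c : k) :
    permFn f n σ (constFn f n c) = constFn f n c :=
  Subtype.ext (funext fun _ => rfl)

/-- Permutation of coordinate functions: `xᵢ ∘ σ = x_{σ i}`. [folklore] -/
@[simp] theorem permFn_coordFn (σ : Equiv.Perm (Fin n)) (i : Fin n) :
    permFn f n σ (coordFn f n i) = coordFn f n (σ i) :=
  Subtype.ext (funext fun _ => rfl)

/-- Permutation of exponentials. [folklore] -/
@[simp] theorem permFn_expFn (σ : Equiv.Perm (Fin n)) (F : termFnRing f n) :
    permFn f n σ (expFn f n F) = expFn f n (permFn f n σ F) :=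
  Subtype.ext (funext fun _ => rfl)

/-- **Non-singular zero sets under a permutation of variables**: `x̄ ∈ Vⁿˢ(F̄ ∘ σ) ↔ x̄ ∘ σ ∈ Vⁿˢ(F̄)`.
[folklore] -/
theorem mem_VnsF_comp_permFn (σ : Equiv.Perm (Fin n)) {p : ℕ} (F : Fin p → termFnRing f n)
    (x : Fin n → K) : x ∈ VnsF f n (fun r => permFn f n σ (F r)) ↔ x ∘ σ ∈ VnsF f n F := by
  have hVF : x ∈ VF f n (fun r => permFn f n σ (F r)) ↔ x ∘ σ ∈ VF f n F := by simp [VF]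
  have hrows : (fun r => jrow f n (permFn f n σ (F r)) x) =
      (LinearEquiv.funCongrLeft K K σ.symm) ∘ fun r => jrow f n (F r) (x ∘ σ) := by
    funext r
    rw [jrow_permFn]
    rfl
  simp only [VnsF, Set.mem_setOf_eq, hVF, hrows]
  refine and_congr Iff.rfl ?_
  exact LinearMap.linearIndependent_iff
    ((LinearEquiv.funCongrLeft K K σ.symm : (Fin n → K) →ₗ[K] (Fin n → K))) (LinearEquiv.ker _)

/-- `k`-rational points under a permutation of variables. [folklore] -/
theorem exists_comp_eq_comp_perm_iff (σ : Equiv.Perm (Fin n)) (x : Fin n → K) :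
    (∃ β : Fin n → k, (f : k → K) ∘ β = x ∘ σ) ↔ ∃ β : Fin n → k, (f : k → K) ∘ β = x := by
  constructor
  · rintro ⟨β, hβ⟩
    refine ⟨β ∘ σ.symm, funext fun i => ?_⟩
    have := congrFun hβ (σ.symm i)
    simpa using this
  · rintro ⟨β, hβ⟩
    exact ⟨β ∘ σ, funext fun i => by simpa using congrFun hβ (σ i)⟩

/-! ### The polynomial stage and its permutation invariance -/

/-- Polynomial functions lie in the polynomial stage `Mₙ = k[x̄]` of every chain. [folklore] -/
theorem polyFn_mem_chain (g : ℕ → termFnRing f n) (P : MvPolynomial (Fin n) k) :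
    polyFn f n P ∈ chain f n g n := by
  induction P using MvPolynomial.induction_on with
  | C c =>
    rw [polyFn_apply, MvPolynomial.eval₂_C, constHom_apply]
    exact constFn_mem_chain f n g c n
  | add p q hp hq => rw [_root_.map_add]; exact Subring.add_mem _ hp hq
  | mul_X p i hp =>
    rw [_root_.map_mul, polyFn_apply (MvPolynomial.X i), MvPolynomial.eval₂_X]
    refine Subring.mul_mem _ hp ?_
    exact chain_mono f n g (Nat.succ_le_of_lt i.isLt) (coordFn_mem_chain f n g i)

/-- **The polynomial stage `Mₙ = k[x̄]` is the ring of polynomial functions**, whatever the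
exponents of the chain. [cite: Wilkie1989, §3, p. 391] -/
theorem chain_n_eq_range_polyFn (g : ℕ → termFnRing f n) : chain f n g n = (polyFn f n).range :=
  le_antisymm (chain_le_range_polyFn g le_rfl) fun _ ⟨P, hP⟩ => hP ▸ polyFn_mem_chain g P

/-- **Permuting the variables of a polynomial function** renames the variables of the polynomial.
[folklore] -/
theorem permFn_polyFn (σ : Equiv.Perm (Fin n)) (P : MvPolynomial (Fin n) k) :
    permFn f n σ (polyFn f n P) = polyFn f n (MvPolynomial.rename σ P) := by
  induction P using MvPolynomial.induction_on with
  | C c =>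
    rw [MvPolynomial.rename_C, polyFn_apply, MvPolynomial.eval₂_C, constHom_apply, permFn_constFn]
  | add p q hp hq => rw [_root_.map_add, _root_.map_add, hp, hq, _root_.map_add, _root_.map_add]
  | mul_X p i hp =>
    rw [_root_.map_mul, _root_.map_mul, hp, _root_.map_mul, MvPolynomial.rename_X, _root_.map_mul,
      polyFn_apply (MvPolynomial.X i), MvPolynomial.eval₂_X, polyFn_apply (MvPolynomial.X (σ i)),
      MvPolynomial.eval₂_X, permFn_coordFn]

/-! ### The permuted chain -/

section Chain

variable (f n)

/-- The exponents of the permuted chain. [cite: Wilkie1989, §6, p. 405] -/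
def permExp (σ : Equiv.Perm (Fin n)) (g : ℕ → termFnRing f n) : ℕ → termFnRing f n :=
  fun m => permFn f n σ (g m)

variable {f n}

/-- **The generators beyond the polynomial stage permute**: `e^{g_m} ∘ σ = e^{g_m ∘ σ}` (`m ≥ n`).
[folklore] -/
theorem permFn_chainGen_of_le (σ : Equiv.Perm (Fin n)) (g : ℕ → termFnRing f n) {m : ℕ}
    (hm : n ≤ m) : permFn f n σ (chainGen f n g m) = chainGen f n (permExp f n σ g) m := by
  rw [chainGen_of_le f n g hm, chainGen_of_le f n (permExp f n σ g) hm, permFn_expFn]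
  rfl

/-- **Permuting the variables maps stage `m ≥ n` of the chain into stage `m` of the permuted
chain** (so a subring of height `≤ j` goes to a subring of height `≤ j`). [cite: Wilkie1989, §6, p. 405] -/
theorem permFn_mem_chain (σ : Equiv.Perm (Fin n)) (g : ℕ → termFnRing f n) {m : ℕ} (hm : n ≤ m)
    {F : termFnRing f n} (hF : F ∈ chain f n g m) : permFn f n σ F ∈ chain f n (permExp f n σ g) m := by
  induction m, hm using Nat.le_induction generalizing F with
  | base =>
    rw [chain_n_eq_range_polyFn g] at hF
    obtain ⟨P, rfl⟩ := hF
    rw [permFn_polyFn]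
    exact polyFn_mem_chain _ _
  | succ m hm ih =>
    obtain ⟨P, rfl⟩ := (mem_chain_succ f n g).1 hF
    rw [Polynomial.eval_map, Polynomial.hom_eval₂, Polynomial.eval₂_eq_sum, Polynomial.sum_def,
      permFn_chainGen_of_le σ g hm]
    refine Subring.sum_mem _ fun e _ => Subring.mul_mem _ ?_ (Subring.pow_mem _ ?_ _)
    · exact chain_le_succ f n _ m (ih (P.coeff e).2)
    · exact chainGen_mem f n (permExp f n σ g) m

/-- **The permuted exponents are admissible.** [folklore] -/
theorem permExp_admissible (σ : Equiv.Perm (Fin n)) {g : ℕ → termFnRing f n}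
    (hg : ∀ i, n ≤ i → g i ∈ chain f n g i) :
    ∀ i, n ≤ i → permExp f n σ g i ∈ chain f n (permExp f n σ g) i :=
  fun i hi => permFn_mem_chain σ g hi (hg i hi)

/-- The permutation restricted to a stage `m ≥ n` of the chain, into stage `m` of the permuted
chain (as a ring homomorphism). [folklore] -/
def permFnStage (σ : Equiv.Perm (Fin n)) (g : ℕ → termFnRing f n) (m : ℕ) (hm : n ≤ m) :
    chain f n g m →+* chain f n (permExp f n σ g) m :=
  (permFn f n σ).restrict (chain f n g m) (chain f n (permExp f n σ g) m)
    fun _ hF => permFn_mem_chain σ g hm hF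

/-- Values of `permFnStage`. [folklore] -/
@[simp] theorem coe_permFnStage (σ : Equiv.Perm (Fin n)) (g : ℕ → termFnRing f n) (m : ℕ)
    (hm : n ≤ m) (F : chain f n g m) :
    ((permFnStage σ g m hm F : chain f n (permExp f n σ g) m) : termFnRing f n) = permFn f n σ F :=
  rfl

/-- **Permuting a polynomial expression**: `(P(Y)) ∘ σ = P^σ(Y ∘ σ)` where `P^σ` has the permuted
coefficients. [folklore] -/
theorem permFn_eval_map (σ : Equiv.Perm (Fin n)) (g : ℕ → termFnRing f n) (m : ℕ) (hm : n ≤ m)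
    (P : Polynomial (chain f n g m)) (Y : termFnRing f n) :
    permFn f n σ ((P.map (chain f n g m).subtype).eval Y) =
      ((P.map (permFnStage σ g m hm)).map (chain f n (permExp f n σ g) m).subtype).eval
        (permFn f n σ Y) := by
  rw [Polynomial.eval_map, Polynomial.hom_eval₂, Polynomial.map_map, Polynomial.eval_map]
  congr 1

/-- **Degrees are preserved by a permutation of variables** (stages `m ≥ n`). [folklore] -/
theorem DegLT.permFn (σ : Equiv.Perm (Fin n)) {g : ℕ → termFnRing f n} {m : ℕ} (hm : n ≤ m)
    {F : termFnRing f n} {s : ℕ} (hF : DegLT (chain f n g m) (chainGen f n g m) F s) :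
    DegLT (chain f n (permExp f n σ g) m) (chainGen f n (permExp f n σ g) m)
      (permFn f n σ F) s := by
  obtain ⟨P, hP, rfl⟩ := hF
  refine ⟨P.map (permFnStage σ g m hm), lt_of_le_of_lt Polynomial.natDegree_map_le hP, ?_⟩
  rw [permFn_eval_map σ g m hm, permFn_chainGen_of_le σ g hm]

end Chain

end RealExpModel

end Literature.ModelTheory.ExponentialFields
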